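import Mathlib
import Summits.Ventures.HodgeRepro.Tier4.Line2.BranchCoefficients

/-!
# Tier4/Line2/TwistAt — the DEFINED weight-shift twist of LINE L2

Blind re-derivation cell `pub-hodge-repro`, Tier 4 (README §9–§10), LINE L2 (t4-plan-2's
`Tier4/Line2/Skeleton.lean` v0.12): the structure `WeightShiftedBranch` carries the weight shift as a FREE
field `twist : Fin 4 → (MvPowerSeries (Fin rank) O.A →ₐ[O.A] MvPowerSeries (Fin rank) O.A)` together with the
free axiom `twist_residue : ∀ j F, map (residue O.A) (twist j F) = map (residue O.A) F` («`ψ_j ≡ 1 (mod 𝔪)`: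
the twist is the identity mod `ϖ`»).  On the genuine object the twist is the substitution
`T_i ↦ ψ_j(γ_i) (1 + T_i) − 1` with `ψ_j(γ_i) ∈ 1 + 𝔪`: its constant term `ψ_j(γ_i) − 1` is only
TOPOLOGICALLY nilpotent, so Mathlib's `MvPowerSeries.subst` (nilpotent constant term) does not apply — which
is why the skeleton left the field free.  This module DEFINES it (seat t4-L2-p2 g4, announced S13795):

* `twistPt u : σ → MvPowerSeries σ R`, `twistPt u s = C (u s) * (1 + X s) - 1`;
* `hasEval_twistPt`: over a linearly topologised `R` (`IsLinearTopology R R`) and a finite `σ`, the family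
  `twistPt u` is a legitimate evaluation point (`MvPowerSeries.HasEval`) as soon as every `u s - 1` is
  topologically nilpotent (Mathlib's `MvPowerSeries.LinearTopology.isTopologicallyNilpotent_of_constantCoeff`);
* `twistAt hu : MvPowerSeries σ R →ₐ[R] MvPowerSeries σ R := MvPowerSeries.aeval (hasEval_twistPt hu)` —
  the substitution `X s ↦ u s (1 + X s) − 1` as a continuous `R`-algebra endomorphism (Pi topology);
  `twistAt_X`, `twistAt_C`, `twistAt_one` (`u = 1` is the identity);
* THE FIELD — `map_residue_twistAt`: for a local ring `R` whose maximal ideal is open and `u s - 1 ∈ 𝔪`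
  for every `s`, `map (residue R) (twistAt hu F) = map (residue R) F` (uniqueness of continuous evaluation
  homomorphisms, `MvPowerSeries.aeval_unique`, applied to `map residue ∘ twistAt` and `map residue`);
  `map_residue_twistAt_X` shows the hypothesis `u s - 1 ∈ 𝔪` is load-bearing;
* the `IsAdic` packaging (`isLinearTopology_of_isAdic`, `isTopologicallyNilpotent_of_mem_of_isAdic`,
  `twistAtAdic`, `map_residue_twistAtAdic`): from `IsAdic 𝔪` and `u s - 1 ∈ 𝔪` alone;
* the evaluation law `aeval_twistAt`: evaluating `twistAt hu F` at a point `η` is evaluating `F` at the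
  twisted point `u s (1 + η s) − 1` (`MvPowerSeries.comp_aeval`) — the arithmetic meaning
  «`(twist j (branch j))(ν) = (branch j)(ψ_j ν)`», the right-hand side of the skeleton's `integral_eq`;
* on `BranchCoefficients`: `BranchCoefficients.twistAt` and `BranchCoefficients.twistAt_residue`, the field
  `twist_residue` in its exact shape.

HOW IT IS CONSUMED (t4-plan-2's cut (vi), S13801): the FILED skeleton is not touched — `twist` stays a field of
`WeightShiftedBranch`; `O.twistAt hadic (u := ψ_j(γ_·)) hu1` / `O.twistAt_residue …` are the instance plugged
into the fields `twist j` / `twist_residue j` at construction time (inside the skeleton's one `sorry`,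
`line2_inputs`), and `aeval_twistAt` at `hη := hasEval_torsionPt O (torsionPt ν) (torsionPt_isTorsion ν)` gives
the right-hand side of the field `integral_eq` its meaning.  NOT CLAIMED: that `twistAt (ψ_j(γ_·))` IS Hsieh's
weight shift on honest data — that identification lives on the paper side of the sorry (CENSUS §B); the Katz
measure, `branch j` and `torsionPt` remain the §G5 typer items.

Imports Mathlib + the landed `Tier4/Line2/BranchCoefficients` only.  No printed input is consumed.
HC_CM is NOT proved by anyone in this repository.
-/

namespace Summit.Ventures.HodgeRepro.Tier4.Line2

open MvPowerSeries Filter Topology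
open scoped MvPowerSeries.WithPiTopology

section generic

variable {σ R : Type*} [CommRing R]

/-- **The twist point** `(u_s (1 + X_s) − 1)_s`: the family of series substituted for the variables by the
weight shift `T_s ↦ u_s (1 + T_s) − 1`. -/
noncomputable def twistPt (u : σ → R) : σ → MvPowerSeries σ R :=
  fun s => C (u s) * (1 + X s) - 1

/-- `twistPt u s = C (u s) * (1 + X s) - 1` (definitional). -/
theorem twistPt_apply (u : σ → R) (s : σ) : twistPt u s = C (u s) * (1 + X s) - 1 := rfl

/-- The constant term of the twist point is `u s − 1`. -/
theorem constantCoeff_twistPt (u : σ → R) (s : σ) :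
    constantCoeff (twistPt u s) = u s - 1 := by
  simp [twistPt]

/-- The trivial weight shift (`u = 1`) has the variables themselves as twist point. -/
theorem twistPt_one (s : σ) : twistPt (fun _ : σ => (1 : R)) s = X s := by
  simp [twistPt]

variable [TopologicalSpace R]

/-- **The twist point is an evaluation point** (Pi topology on `MvPowerSeries σ R`): over a linearly
topologised ring, a power series is topologically nilpotent iff its constant term is
(`MvPowerSeries.LinearTopology.isTopologicallyNilpotent_of_constantCoeff`), and the finiteness of `σ`
gives the cofinite condition. -/
theorem hasEval_twistPt [Finite σ] [IsLinearTopology R R] {u : σ → R}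
    (hu : ∀ s, IsTopologicallyNilpotent (u s - 1)) : HasEval (twistPt u) where
  hpow s := by
    apply MvPowerSeries.LinearTopology.isTopologicallyNilpotent_of_constantCoeff
    rw [constantCoeff_twistPt]
    exact hu s
  tendsto_zero := by
    rw [Filter.cofinite_eq_bot]
    exact tendsto_bot

end generic

section aevalCongr

variable {σ R : Type*} [CommRing R] [UniformSpace R] [IsUniformAddGroup R] [IsTopologicalRing R]

/-- Two evaluation homomorphisms at equal points are equal (the `HasEval` proof is a proposition). -/
theorem aeval_congr {S : Type*} [CommRing S] [UniformSpace S] [IsUniformAddGroup S]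
    [IsTopologicalRing S] [IsLinearTopology S S] [T2Space S] [Algebra R S] [ContinuousSMul R S]
    [CompleteSpace S] {a b : σ → S} (h : a = b) (ha : HasEval a) (hb : HasEval b) :
    MvPowerSeries.aeval (R := R) ha = MvPowerSeries.aeval (R := R) hb := by
  subst h
  rfl

end aevalCongr

section twistAt

variable {σ R : Type*} [CommRing R] [UniformSpace R] [IsUniformAddGroup R] [IsTopologicalRing R]
  [CompleteSpace R] [T2Space R] [IsLinearTopology R R] [Finite σ]

/-- **The weight-shift twist** `X s ↦ u s (1 + X s) − 1`, as a continuous `R`-algebra endomorphism of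
`MvPowerSeries σ R` (Mathlib's `MvPowerSeries.aeval` at the twist point). -/
noncomputable def twistAt {u : σ → R} (hu : ∀ s, IsTopologicallyNilpotent (u s - 1)) :
    MvPowerSeries σ R →ₐ[R] MvPowerSeries σ R :=
  MvPowerSeries.aeval (hasEval_twistPt hu)

/-- `twistAt hu` is `aeval` at the twist point (definitional). -/
theorem twistAt_def {u : σ → R} (hu : ∀ s, IsTopologicallyNilpotent (u s - 1)) :
    twistAt hu = MvPowerSeries.aeval (hasEval_twistPt hu) := rfl

/-- The twist is continuous for the Pi topology. -/
theorem continuous_twistAt {u : σ → R} (hu : ∀ s, IsTopologicallyNilpotent (u s - 1)) :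
    Continuous (twistAt hu) :=
  MvPowerSeries.continuous_aeval (hasEval_twistPt hu)

/-- The twist sends the variable `X s` to `u s (1 + X s) − 1`. -/
theorem twistAt_X {u : σ → R} (hu : ∀ s, IsTopologicallyNilpotent (u s - 1)) (s : σ) :
    twistAt hu (X s) = C (u s) * (1 + X s) - 1 := by
  rw [twistAt_def, MvPowerSeries.coe_aeval, MvPowerSeries.eval₂_X]
  rfl

/-- The twist fixes the constants. -/
theorem twistAt_C {u : σ → R} (hu : ∀ s, IsTopologicallyNilpotent (u s - 1)) (r : R) :
    twistAt hu (C r) = C r := by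
  rw [MvPowerSeries.c_eq_algebraMap]
  exact (twistAt hu).commutes r

/-- **Junk test — the trivial weight shift is the identity**: `twistAt` at `u = 1` is `AlgHom.id`
(uniqueness of continuous evaluation homomorphisms, `MvPowerSeries.aeval_unique`). -/
theorem twistAt_one (hu : ∀ s : σ, IsTopologicallyNilpotent ((fun _ : σ => (1 : R)) s - 1)) :
    twistAt hu = AlgHom.id R (MvPowerSeries σ R) := by
  have hid : Continuous (AlgHom.id R (MvPowerSeries σ R)) := by
    simpa only [AlgHom.coe_id] using continuous_id
  rw [twistAt_def, ← MvPowerSeries.aeval_unique hid]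
  exact aeval_congr (funext fun s => by simp [twistPt_one]) _ _

end twistAt

section residueContinuity

variable {σ R : Type*} [CommRing R] [TopologicalSpace R] [IsTopologicalRing R] [IsLocalRing R]

/-- The residue map is continuous into the discrete residue field as soon as the maximal ideal is open. -/
theorem continuous_residue_of_isOpen [TopologicalSpace (IsLocalRing.ResidueField R)]
    [DiscreteTopology (IsLocalRing.ResidueField R)]
    (hopen : IsOpen (IsLocalRing.maximalIdeal R : Set R)) :
    Continuous (IsLocalRing.residue R) := by
  apply continuous_of_continuousAt_zero (IsLocalRing.residue R)
  rw [ContinuousAt, map_zero, nhds_discrete (IsLocalRing.ResidueField R), tendsto_pure]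
  filter_upwards [hopen.mem_nhds (IsLocalRing.maximalIdeal R).zero_mem] with r hr
  exact (IsLocalRing.residue_eq_zero_iff r).2 hr

/-- Reduction of coefficients is continuous for the Pi topologies (residue field discrete, `𝔪` open). -/
theorem continuous_map_residue_of_isOpen [TopologicalSpace (IsLocalRing.ResidueField R)]
    [DiscreteTopology (IsLocalRing.ResidueField R)]
    (hopen : IsOpen (IsLocalRing.maximalIdeal R : Set R)) :
    Continuous (MvPowerSeries.map (σ := σ) (IsLocalRing.residue R)) := by
  have hres := continuous_residue_of_isOpen (R := R) hopen
  simp only [continuous_iff_continuousAt]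
  intro F
  refine (MvPowerSeries.WithPiTopology.tendsto_iff_coeff_tendsto _ _ _).mpr fun d => ?_
  simp only [MvPowerSeries.coeff_map]
  exact (hres.tendsto _).comp ((MvPowerSeries.WithPiTopology.continuous_coeff (R := R) d).tendsto F)

/-- The scalar action of `R` on the discrete residue field is continuous when `𝔪` is open. -/
theorem continuousSMul_residueField_of_isOpen [TopologicalSpace (IsLocalRing.ResidueField R)]
    [DiscreteTopology (IsLocalRing.ResidueField R)]
    (hopen : IsOpen (IsLocalRing.maximalIdeal R : Set R)) :
    ContinuousSMul R (IsLocalRing.ResidueField R) := by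
  have hres := continuous_residue_of_isOpen (R := R) hopen
  refine ⟨?_⟩
  have : (fun p : R × IsLocalRing.ResidueField R => p.1 • p.2) =
      fun p => IsLocalRing.residue R p.1 * p.2 := by
    funext p
    rw [Algebra.smul_def, IsLocalRing.ResidueField.algebraMap_eq]
  rw [this]
  exact (hres.comp continuous_fst).mul continuous_snd

end residueContinuity

section residue

variable {σ R : Type*} [CommRing R] [UniformSpace R] [IsUniformAddGroup R] [IsTopologicalRing R]
  [CompleteSpace R] [T2Space R] [IsLinearTopology R R] [Finite σ] [IsLocalRing R]

/-- **THE FIELD `twist_residue`, DEFINED**: when the maximal ideal is open and every `u s − 1` lies in it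
(`u s ≡ 1 (mod 𝔪)`), the twist is the identity modulo `𝔪` — `map residue ∘ twistAt = map residue`.
Proof: both sides are continuous `R`-algebra homomorphisms `MvPowerSeries σ R → MvPowerSeries σ k` (`k` the
residue field with the discrete uniformity), hence evaluation homomorphisms at their values on the variables
(`MvPowerSeries.aeval_unique`); these values agree because `residue (u s) = 1`. -/
theorem map_residue_twistAt (hopen : IsOpen (IsLocalRing.maximalIdeal R : Set R)) {u : σ → R}
    (hu : ∀ s, IsTopologicallyNilpotent (u s - 1)) (hu1 : ∀ s, u s - 1 ∈ IsLocalRing.maximalIdeal R)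
    (F : MvPowerSeries σ R) :
    MvPowerSeries.map (IsLocalRing.residue R) (twistAt hu F) =
      MvPowerSeries.map (IsLocalRing.residue R) F := by
  letI : UniformSpace (IsLocalRing.ResidueField R) := ⊥
  haveI : DiscreteTopology (IsLocalRing.ResidueField R) := inferInstance
  haveI := continuousSMul_residueField_of_isOpen (R := R) hopen
  have hmap := continuous_map_residue_of_isOpen (σ := σ) (R := R) hopen
  -- the two algebra homomorphisms
  let ε₂ : MvPowerSeries σ R →ₐ[R] MvPowerSeries σ (IsLocalRing.ResidueField R) :=
    MvPowerSeries.mapAlgHom (Algebra.ofId R (IsLocalRing.ResidueField R))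
  let ε₁ : MvPowerSeries σ R →ₐ[R] MvPowerSeries σ (IsLocalRing.ResidueField R) :=
    ε₂.comp (twistAt hu)
  have hε₂ : Continuous ε₂ := hmap
  have hε₁ : Continuous ε₁ := hmap.comp (continuous_twistAt hu)
  have key : ε₁ = ε₂ := by
    rw [← MvPowerSeries.aeval_unique hε₁, ← MvPowerSeries.aeval_unique hε₂]
    refine aeval_congr (funext fun s => ?_) _ _
    have h1 : IsLocalRing.residue R (u s) = 1 := by
      have := (IsLocalRing.residue_eq_zero_iff (u s - 1)).2 (hu1 s)
      rwa [map_sub, map_one, sub_eq_zero] at this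
    show MvPowerSeries.map (IsLocalRing.residue R) (twistAt hu (X s)) =
      MvPowerSeries.map (IsLocalRing.residue R) (X s)
    rw [twistAt_X]
    simp only [map_sub, map_mul, map_add, map_one, MvPowerSeries.map_C, MvPowerSeries.map_X, h1,
      one_mul, add_sub_cancel_left]
  exact DFunLike.congr_fun key F

/-- **Junk test — the hypothesis `u s − 1 ∈ 𝔪` is load-bearing**: on the variable `X s` the reduction of the
twist is `residue (u s) (1 + X s) − 1`, whose constant term is `residue (u s) − 1`. -/
theorem map_residue_twistAt_X {u : σ → R} (hu : ∀ s, IsTopologicallyNilpotent (u s - 1)) (s : σ) :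
    MvPowerSeries.map (IsLocalRing.residue R) (twistAt hu (X s)) =
      C (IsLocalRing.residue R (u s)) * (1 + X s) - 1 := by
  rw [twistAt_X]
  simp only [map_sub, map_mul, map_add, map_one, MvPowerSeries.map_C, MvPowerSeries.map_X]

/-- The reduction of `twistAt hu (X s)` is NOT `X s` when `residue (u s) ≠ 1` (compare constant terms). -/
theorem map_residue_twistAt_X_ne {u : σ → R} (hu : ∀ s, IsTopologicallyNilpotent (u s - 1)) (s : σ)
    (h : IsLocalRing.residue R (u s) ≠ 1) :
    MvPowerSeries.map (IsLocalRing.residue R) (twistAt hu (X s)) ≠ X s := by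
  intro hX
  have := congrArg constantCoeff hX
  rw [map_residue_twistAt_X] at this
  simp only [map_sub, map_mul, constantCoeff_C, map_add, map_one, constantCoeff_X, add_zero, mul_one]
    at this
  exact h (sub_eq_zero.1 this)

end residue

section adic

variable {R : Type*} [CommRing R] [TopologicalSpace R]

/-- A ring with the `J`-adic topology is linearly topologised. -/
theorem isLinearTopology_of_isAdic {J : Ideal R} (hJ : IsAdic J) : IsLinearTopology R R :=
  IsLinearTopology.mk_of_hasBasis _ hJ.hasBasis_nhds_zero

/-- In the `J`-adic topology every element of `J` is topologically nilpotent. -/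
theorem isTopologicallyNilpotent_of_mem_of_isAdic {J : Ideal R} (hJ : IsAdic J) {x : R} (hx : x ∈ J) :
    IsTopologicallyNilpotent x := by
  rw [IsTopologicallyNilpotent, hJ.hasBasis_nhds_zero.tendsto_right_iff]
  intro n _
  filter_upwards [Filter.eventually_ge_atTop n] with m hm
  exact Ideal.pow_le_pow_right hm (Ideal.pow_mem_pow hx m)

/-- In the `J`-adic topology `J` itself is open. -/
theorem isOpen_of_isAdic [IsTopologicalRing R] {J : Ideal R} (hJ : IsAdic J) : IsOpen (J : Set R) := by
  have := (isAdic_iff.1 hJ).1 1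
  rwa [pow_one] at this

end adic

section twistAtAdic

variable {σ R : Type*} [CommRing R] [UniformSpace R] [IsUniformAddGroup R] [IsTopologicalRing R]
  [CompleteSpace R] [T2Space R] [Finite σ] [IsLocalRing R]

/-- **The twist from the `𝔪`-adic data alone**: for a complete local ring with the `𝔪`-adic topology and
`u s ≡ 1 (mod 𝔪)`, the weight shift `X s ↦ u s (1 + X s) − 1`. -/
noncomputable def twistAtAdic (hadic : IsAdic (IsLocalRing.maximalIdeal R)) {u : σ → R}
    (hu1 : ∀ s, u s - 1 ∈ IsLocalRing.maximalIdeal R) :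
    MvPowerSeries σ R →ₐ[R] MvPowerSeries σ R :=
  haveI := isLinearTopology_of_isAdic hadic
  twistAt fun s => isTopologicallyNilpotent_of_mem_of_isAdic hadic (hu1 s)

/-- `twistAtAdic` on the variables. -/
theorem twistAtAdic_X (hadic : IsAdic (IsLocalRing.maximalIdeal R)) {u : σ → R}
    (hu1 : ∀ s, u s - 1 ∈ IsLocalRing.maximalIdeal R) (s : σ) :
    twistAtAdic hadic hu1 (X s) = C (u s) * (1 + X s) - 1 := by
  haveI := isLinearTopology_of_isAdic hadic
  exact twistAt_X _ s

/-- **The field `twist_residue` from the `𝔪`-adic data alone.** -/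
theorem map_residue_twistAtAdic (hadic : IsAdic (IsLocalRing.maximalIdeal R)) {u : σ → R}
    (hu1 : ∀ s, u s - 1 ∈ IsLocalRing.maximalIdeal R) (F : MvPowerSeries σ R) :
    MvPowerSeries.map (IsLocalRing.residue R) (twistAtAdic hadic hu1 F) =
      MvPowerSeries.map (IsLocalRing.residue R) F := by
  haveI := isLinearTopology_of_isAdic hadic
  exact map_residue_twistAt (isOpen_of_isAdic hadic) _ hu1 F

end twistAtAdic

section evaluationPt

variable {σ R : Type*} [CommRing R] [UniformSpace R] [IsUniformAddGroup R] [IsTopologicalRing R]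
  {S : Type*} [CommRing S] [UniformSpace S] [IsUniformAddGroup S] [IsTopologicalRing S]
  [IsLinearTopology S S] [T2Space S] [Algebra R S] [ContinuousSMul R S] [CompleteSpace S]

/-- Evaluating the twist point at an evaluation point `η` gives the twisted point `u s (1 + η s) − 1`. -/
theorem aeval_twistPt {u : σ → R} {η : σ → S} (hη : HasEval η) :
    (fun s => MvPowerSeries.aeval hη (twistPt u s)) =
      fun s => algebraMap R S (u s) * (1 + η s) - 1 := by
  funext s
  rw [twistPt_apply, map_sub, map_mul, map_add, map_one, MvPowerSeries.c_eq_algebraMap,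
    AlgHom.commutes, MvPowerSeries.coe_aeval, MvPowerSeries.eval₂_X]

end evaluationPt

section evaluation

variable {σ R : Type*} [CommRing R] [UniformSpace R] [IsUniformAddGroup R] [IsTopologicalRing R]
  [CompleteSpace R] [T2Space R] [IsLinearTopology R R] [Finite σ]
  {S : Type*} [CommRing S] [UniformSpace S] [IsUniformAddGroup S] [IsTopologicalRing S]
  [IsLinearTopology S S] [T2Space S] [Algebra R S] [ContinuousSMul R S] [CompleteSpace S]

omit [CompleteSpace R] [T2Space R] in
/-- The twisted evaluation point `u s (1 + η s) − 1` of an evaluation point `η` is an evaluation point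
(it is the image of the twist point under the continuous evaluation at `η`). -/
theorem hasEval_twistPt_aeval {u : σ → R} (hu : ∀ s, IsTopologicallyNilpotent (u s - 1)) {η : σ → S}
    (hη : HasEval η) : HasEval (fun s => algebraMap R S (u s) * (1 + η s) - 1) :=
  aeval_twistPt (u := u) hη ▸ (hasEval_twistPt hu).map (MvPowerSeries.continuous_aeval hη)

/-- **The evaluation law** — the arithmetic meaning of the weight shift: evaluating the twisted series at the
point `η` is evaluating the original series at the twisted point `u s (1 + η s) − 1`
(`MvPowerSeries.comp_aeval`).  For `η` a torsion point `ν` of the formal torus this is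
«`(twist j (branch j))(ν) = (branch j)(ψ_j ν)`», the right-hand side of the skeleton's `integral_eq`. -/
theorem aeval_twistAt {u : σ → R} (hu : ∀ s, IsTopologicallyNilpotent (u s - 1)) {η : σ → S}
    (hη : HasEval η) (F : MvPowerSeries σ R) :
    MvPowerSeries.aeval hη (twistAt hu F) =
      MvPowerSeries.aeval (R := R) (hasEval_twistPt_aeval hu hη) F := by
  have h := MvPowerSeries.comp_aeval (hasEval_twistPt hu) (MvPowerSeries.continuous_aeval hη)
  rw [twistAt_def, ← AlgHom.comp_apply, h]
  exact DFunLike.congr_fun (aeval_congr (R := R) (aeval_twistPt hη) _ _) F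

end evaluation

section branchCoefficients

/-- **The weight-shift twist of LINE L2 on the coefficient ring `O` of the Katz measures** (the field
`WeightShiftedBranch.twist j`, DEFINED): `T_i ↦ u_i (1 + T_i) − 1` for `u_i := ψ_j(γ_i) ∈ 1 + 𝔪`, given that
the topology of `O` is the `𝔪`-adic one (complete, Hausdorff). -/
noncomputable def BranchCoefficients.twistAt (O : BranchCoefficients) {d : ℕ}
    (hadic : IsAdic (IsLocalRing.maximalIdeal O.A)) [CompleteSpace O.A] [T2Space O.A]
    {u : Fin d → O.A} (hu1 : ∀ i, u i - 1 ∈ IsLocalRing.maximalIdeal O.A) :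
    MvPowerSeries (Fin d) O.A →ₐ[O.A] MvPowerSeries (Fin d) O.A :=
  twistAtAdic hadic hu1

/-- **The field `WeightShiftedBranch.twist_residue`, DEFINED**: `ψ_j ≡ 1 (mod 𝔪)` makes the twist the identity
mod `ϖ` — in the exact shape of the skeleton's field. -/
theorem BranchCoefficients.twistAt_residue (O : BranchCoefficients) {d : ℕ}
    (hadic : IsAdic (IsLocalRing.maximalIdeal O.A)) [CompleteSpace O.A] [T2Space O.A]
    {u : Fin d → O.A} (hu1 : ∀ i, u i - 1 ∈ IsLocalRing.maximalIdeal O.A) :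
    ∀ F, MvPowerSeries.map (IsLocalRing.residue O.A) (O.twistAt hadic hu1 F) =
      MvPowerSeries.map (IsLocalRing.residue O.A) F :=
  fun F => map_residue_twistAtAdic hadic hu1 F

/-- The twist on the variables, on `O`. -/
theorem BranchCoefficients.twistAt_X (O : BranchCoefficients) {d : ℕ}
    (hadic : IsAdic (IsLocalRing.maximalIdeal O.A)) [CompleteSpace O.A] [T2Space O.A]
    {u : Fin d → O.A} (hu1 : ∀ i, u i - 1 ∈ IsLocalRing.maximalIdeal O.A) (i : Fin d) :
    O.twistAt hadic hu1 (X i) = C (u i) * (1 + X i) - 1 :=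
  twistAtAdic_X hadic hu1 i

end branchCoefficients

end Summit.Ventures.HodgeRepro.Tier4.Line2
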